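import Mathlib
import HarnessLib

/-!
# The tower-vanishing lemma of the `Λ`-adic road to SURJ⁺@2 (first input of item 23110 at every rank): a TORSION-FREE module
# read through a tower of torsion-free layers of BOUNDED rank, each killed by a non-zero scalar, is ZERO — pure algebra

Routes `ResidualThetaTransportAtTwo` (RTT, crux r201 `ResidualLambdaFormulaNegDiscAtTwo`, stmt-BirchSwinnertonDyer-23110) /
`ThetaPartnerAtTwo` (K1, line `bridge`, registered stub `stub_surj2` = Greenberg–Vatsal Prop. (2.1) READ AT `2`). Seat `prover-bsd-rtt-w4`
(width w4 of keying brief (195)); `--supports stmt-BirchSwinnertonDyer-23110`. THEOREMS ONLY, PURE ALGEBRA (no definition, no named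
fact, no `sorry`); nothing about any Selmer group is asserted here.

WHY (the `Λ`-adic road, seat NOTES / memo ALL-RANK-RLF-ROADS-w4g0). At every rank SURJ⁺@2 for `E` follows from Poitou–Tate at the
finite layers `ℚ_m` (tree THEOREM `poitouTate_selmerStructure_duality_numberField`) once the «universal-norm compact `+` Selmer group»
`𝔖⁺_∞ = lim←_m 𝔖⁺(E/ℚ_m)` (norm-compatible systems of compact Selmer classes) VANISHES: the obstruction to lifting a family of local
classes at layer `m` pairs, under the local Tate pairings, with `cor(𝔖⁺(E/ℚ_{m'}))`, `m' ≫ m`. Classically `𝔖_∞ = 0` is read off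
the `Λ`-adic corank calculus (weak Leopoldt + Euler characteristics; Greenberg–Vatsal 2000 Prop. (2.1) / Perrin-Riou). THIS FILE
isolates a corank-free mechanism: `𝔖⁺_∞` is a `Λ`-submodule of Kato's torsion-free `𝐇¹_Γ(T_2E)` (tree THEOREM, Kato Thm. 12.4 (2)
first half, `IwasawaH1LambdaTorsionFreeProofs`), its image in the layer `𝔖⁺(E/ℚ_m) ⊂ H¹(ℚ_m, T_2E)` is a torsion-free `ℤ₂`-module
(`E(ℚ_∞)[2] = 0`) of rank `≤ rank_{ℤ₂} X⁺ = λ⁺` (`X⁺` torsion with `μ = 0`; easy half of control), the kernels of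
`𝔖_∞ → 𝔖⁺(E/ℚ_m)` decrease to `0` and contain `ω_m 𝔖_∞`, `ω_m = γ^{2^m} − 1 ≠ 0`. Then:

* `exists_eq_bot_of_antitone_of_rank_le` — for a module `M` over a commutative domain `A` and a decreasing sequence of submodules
  `K n` with `⋂ K n = 0`, torsion-free quotients `M ⧸ K n` of rank `≤ B` (uniformly): SOME `K n₀` is already `0`
  (the ranks stabilise; a surjection between torsion-free modules of equal finite rank over a domain has torsion-free kernel of
  rank `0`, i.e. is injective — rank–nullity `LinearMap.rank_range_add_rank_ker` over `IsDomain.hasRankNullity`);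
* `forall_eq_zero_of_antitone_of_rank_le_of_smul_mem` — if moreover a ring `R` acts on `M` without torsion (`a • m = 0 ⇒ a = 0 ∨ m = 0`)
  and each `K n` contains `a_n • M` for some `a_n ≠ 0` in `R`, then `M = 0`.

With `A = ℤ₂`, `R = Λ = ℤ₂⟦T⟧`, `M = 𝔖⁺_∞`, `K m = ker(𝔖_∞ → 𝔖⁺(E/ℚ_m))`, `a_m = ω_m` this is `𝔖⁺_∞ = 0` — no weak Leopoldt, no
`Λ`-adic `H²`, no corank of `H¹(ℚ_Σ/ℚ_∞, E[2^∞])`. (A torsion example shows the torsion-freeness of the layers cannot be dropped: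
`Λ/(2^m T, ω_m)` has `ℤ₂`-rank `1` for every `m`, with `⋂_m (2^m T, ω_m) = 0`.)
HONEST FRAMING: closes nothing; BSD is not proved by any of this.
References: [GreenbergVatsal2000] §2 Prop. (2.1); [GreenbergLNM1716] §4 Props. 4.12–4.14; [Kato2004Asterisque] §12.2, Thm. 12.4 (2);
[PerrinRiou1992] (universal norms); [NeukirchSchmidtWingberg2008] Ch. V §3 (structure of Iwasawa modules).
-/

set_option autoImplicit false
-- D-0017: single-problem summit, so `Summit.BirchSwinnertonDyer.BirchSwinnertonDyer.…` repeats a namespace BY DESIGN.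
set_option linter.dupNamespace false

universe u v w

namespace Summit.BirchSwinnertonDyer.BirchSwinnertonDyer.Theorems.ResidualThetaLayer.TowerVanishing

open Filter Topology

/-- A monotone sequence of natural numbers bounded above is eventually constant. [folklore] -/
theorem exists_forall_ge_eq_of_monotone_of_le (t : ℕ → ℕ) (hmono : Monotone t) (B : ℕ) (hB : ∀ n, t n ≤ B) :
    ∃ n₀ : ℕ, ∀ n, n₀ ≤ n → t n = t n₀ := by
  have hbdd : BddAbove (Set.range t) := ⟨B, by rintro _ ⟨n, rfl⟩; exact hB n⟩
  have hlim : Tendsto t atTop (𝓝 (⨆ i, t i)) := tendsto_atTop_ciSup hmono hbdd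
  rw [nhds_discrete, tendsto_pure] at hlim
  obtain ⟨n₀, hn₀⟩ := eventually_atTop.mp hlim
  exact ⟨n₀, fun n hn ↦ by rw [hn₀ n hn, hn₀ n₀ le_rfl]⟩

section Domain

variable {A : Type u} [CommRing A] [IsDomain A] {M : Type v} [AddCommGroup M] [Module A M]

/-- **A surjection between torsion-free modules of the same finite rank over a commutative domain is injective** (its kernel is
torsion-free of rank `0` by rank–nullity). [folklore] -/
theorem ker_eq_bot_of_surjective_of_rank_eq {N : Type v} [AddCommGroup N] [Module A N] [Module.IsTorsionFree A M]
    (f : M →ₗ[A] N) (hf : Function.Surjective f) (r : ℕ) (hM : Module.rank A M = r) (hN : Module.rank A N = r) :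
    LinearMap.ker f = ⊥ := by
  have hrn := LinearMap.rank_range_add_rank_ker f
  rw [LinearMap.range_eq_top.mpr hf, rank_top, hN, hM] at hrn
  -- `r + rank ker = r` with `r` finite forces `rank ker = 0`
  have hker : Module.rank A (LinearMap.ker f) = 0 := by
    have hle : Module.rank A (LinearMap.ker f) ≤ (r : Cardinal) := by
      calc Module.rank A (LinearMap.ker f) ≤ (r : Cardinal) + Module.rank A (LinearMap.ker f) := le_add_self
        _ = r := hrn
    have hlt : Module.rank A (LinearMap.ker f) < Cardinal.aleph0 := lt_of_le_of_lt hle ((Cardinal.natCast_lt_aleph0 (n := r)))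
    obtain ⟨k, hk⟩ := Cardinal.lt_aleph0.mp hlt
    rw [hk] at hrn ⊢
    norm_cast at hrn ⊢
    omega
  rw [rank_zero_iff_forall_zero] at hker
  exact (Submodule.eq_bot_iff _).mpr fun x hx ↦ by simpa using congrArg Subtype.val (hker ⟨x, hx⟩)

/-- **Stabilisation ⇒ vanishing.** Let `K n` be a DECREASING sequence of submodules of `M` (over a commutative domain `A`) with
`⋂ₙ K n = 0`, such that every quotient `M ⧸ K n` is torsion-free of rank `≤ B`. Then some `K n₀ = 0` (indeed all `K n`, `n ≥ n₀`):
the ranks `rank (M ⧸ K n)` increase and are bounded, hence stabilise from some `n₀` on; for `n ≥ n₀` the surjection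
`M ⧸ K n → M ⧸ K n₀` is then injective (`ker_eq_bot_of_surjective_of_rank_eq`), i.e. `K n₀ ≤ K n`, so `K n₀ ≤ ⋂ₙ K n = 0`.
[cite: NeukirchSchmidtWingberg2008, Ch. V §3 (compact `Λ`-modules and their layers)] -/
theorem exists_eq_bot_of_antitone_of_rank_le (K : ℕ → Submodule A M) (hanti : Antitone K)
    (hsep : ∀ m : M, (∀ n, m ∈ K n) → m = 0) (htf : ∀ n, Module.IsTorsionFree A (M ⧸ K n))
    (B : ℕ) (hrank : ∀ n, Module.rank A (M ⧸ K n) ≤ B) :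
    ∃ n₀ : ℕ, ∀ n, n₀ ≤ n → K n = ⊥ := by
  -- the ranks as natural numbers
  have hfin : ∀ n, Module.rank A (M ⧸ K n) < Cardinal.aleph0 := fun n ↦
    lt_of_le_of_lt (hrank n) (Cardinal.natCast_lt_aleph0 (n := B))
  choose t ht using fun n ↦ Cardinal.lt_aleph0.mp (hfin n)
  -- the comparison maps `M ⧸ K n' → M ⧸ K n` for `n ≤ n'`
  let φ : ∀ n n' : ℕ, n ≤ n' → (M ⧸ K n') →ₗ[A] (M ⧸ K n) := fun n n' h ↦
    (K n').liftQ (K n).mkQ (by rw [Submodule.ker_mkQ]; exact hanti h)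
  have hφ : ∀ n n' (h : n ≤ n') (x : M), φ n n' h (Submodule.Quotient.mk x) = Submodule.Quotient.mk x :=
    fun n n' h x ↦ rfl
  have hφsurj : ∀ n n' (h : n ≤ n'), Function.Surjective (φ n n' h) := by
    intro n n' h y
    induction y using Submodule.Quotient.induction_on with
    | H x => exact ⟨Submodule.Quotient.mk x, hφ n n' h x⟩
  -- monotone and bounded
  have hmono : Monotone t := by
    intro n n' h
    have hle := LinearMap.rank_le_of_surjective (φ n n' h) (hφsurj n n' h)
    rw [ht n, ht n'] at hle
    exact_mod_cast hle
  have htB : ∀ n, t n ≤ B := fun n ↦ by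
    have := hrank n; rw [ht n] at this; exact_mod_cast this
  obtain ⟨n₀, hn₀⟩ := exists_forall_ge_eq_of_monotone_of_le t hmono B htB
  -- for `n ≥ n₀` the comparison map is injective, so `K n₀ ≤ K n`
  have hK : ∀ n, n₀ ≤ n → K n₀ ≤ K n := by
    intro n hn x hx
    haveI := htf n
    have hker := ker_eq_bot_of_surjective_of_rank_eq (φ n₀ n hn) (hφsurj n₀ n hn) (t n) (ht n)
      (by rw [ht n₀, hn₀ n hn])
    have hx0 : φ n₀ n hn (Submodule.Quotient.mk x) = 0 := by
      rw [hφ n₀ n hn x, Submodule.Quotient.mk_eq_zero]; exact hx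
    have hmem : Submodule.Quotient.mk (p := K n) x ∈ LinearMap.ker (φ n₀ n hn) := hx0
    rw [hker, Submodule.mem_bot, Submodule.Quotient.mk_eq_zero] at hmem
    exact hmem
  -- hence `K n₀ ≤ ⋂ K n = 0`
  have hbot : K n₀ = ⊥ := by
    refine (Submodule.eq_bot_iff _).mpr fun x hx ↦ hsep x fun n ↦ ?_
    rcases le_or_gt n₀ n with h | h
    · exact hK n h hx
    · exact hanti h.le hx
  refine ⟨n₀, fun n hn ↦ le_bot_iff.mp ?_⟩
  calc K n ≤ K n₀ := hanti hn
    _ = ⊥ := hbot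

end Domain

/-- **The tower-vanishing lemma.** Let `R` be a ring acting without torsion on `M` (`a • m = 0 ⇒ a = 0 ∨ m = 0`), `A` a commutative
domain also acting on `M`, and `K n` a decreasing sequence of `A`-submodules with `⋂ₙ K n = 0`, torsion-free quotients `M ⧸ K n` of
`A`-rank `≤ B`, and each containing `a_n • M` for some non-zero `a_n ∈ R`. Then `M = 0`. (For the compact signed Selmer tower:
`R = Λ`, `A = ℤ_p`, `a_n = ω_n`; the torsion-freeness of `M = 𝔖_∞` is inherited from Kato's `𝐇¹`.)
[cite: GreenbergVatsal2000, §2 Prop. (2.1)] [cite: Kato2004Asterisque, Thm. 12.4 (2)] -/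
theorem forall_eq_zero_of_antitone_of_rank_le_of_smul_mem {R : Type w} [Ring R] {A : Type u} [CommRing A] [IsDomain A]
    {M : Type v} [AddCommGroup M] [Module A M] [Module R M]
    (htfR : ∀ (a : R) (m : M), a • m = 0 → a = 0 ∨ m = 0)
    (K : ℕ → Submodule A M) (hanti : Antitone K) (hsep : ∀ m : M, (∀ n, m ∈ K n) → m = 0)
    (htf : ∀ n, Module.IsTorsionFree A (M ⧸ K n)) (B : ℕ) (hrank : ∀ n, Module.rank A (M ⧸ K n) ≤ B)
    (hkill : ∀ n, ∃ a : R, a ≠ 0 ∧ ∀ m : M, a • m ∈ K n) :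
    ∀ m : M, m = 0 := by
  obtain ⟨n₀, hn₀⟩ := exists_eq_bot_of_antitone_of_rank_le K hanti hsep htf B hrank
  obtain ⟨a, ha, haK⟩ := hkill n₀
  intro m
  have h0 : a • m = 0 := by
    have := haK m
    rw [hn₀ n₀ le_rfl, Submodule.mem_bot] at this
    exact this
  exact (htfR a m h0).resolve_left ha

end Summit.BirchSwinnertonDyer.BirchSwinnertonDyer.Theorems.ResidualThetaLayer.TowerVanishing
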